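import Summits.NavierStokesRegularity.NavierStokesRegularity.Theorems.SqueezeCycleMustSqueezeSignedBudget
import HarnessLib

/-!
# Route `SqueezeCycle`, crux `ExtremalBiaxialitySubcritical` — the signed-budget lever in PRODUCTION currency (line `quarter-bootstrap-pinning`)

Helper file for item `stmt-NavierStokesRegularity-11609`
(`Summit.NavierStokesRegularity.NavierStokesRegularity.Theses.SqueezeCycle.ExtremalBiaxialitySubcritical`),
registered sub-goal `stub_signedBudgetProduction` of line `quarter-bootstrap-pinning`.

The sibling crux `MustSqueeze` (stmt-NavierStokesRegularity-11610, line `outward-drift-signed-flux`) landed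
its lever `Theorems.stub_signedBudget` — the localised similarity enstrophy inequality
`Z_R' ≤ −2(¼ − a) Z_R + K_R`, `0 ≤ K_R ≤ κ (E(2R)/R + √(E(2R)/R))` — under the middle-eigenvalue
hypothesis `hΛ : ∀ t < 0, ∀ x, lerayMiddleStrain u t x ≤ a`.  In its proof `hΛ` is consumed in exactly
one place: the pointwise production bound on the similarity orbit
`⟪∇U Ω, Ω⟫ ≤ 4 det ∇U + a (2‖∇U‖²_F − ‖Ω‖²)` (`signedBudget_production_pointwise`), which is then
integrated against the cutoff (`signedBudget_production_integral_le`) and fed to the static bound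
(`signedBudget_lever_static_bound`).  This file re-runs that chain with the pointwise production bound
taken as the HYPOTHESIS (`hprod`) — the currency-free form of the lever needed by the quarter bootstrap
of this crux, whose stub `stub_leakyQuarterLawCeiling` supplies `hprod` from a production CEILING
`−4 det S ≤ (2b/(−t)) |S|²_F` (Betchov) rather than from `Λ ≤ a` (Miller):

* `productionLever_production_integral_le` — `∫ φ_R ⟪∇U Ω, Ω⟫ ≤ 4 ∫ φ_R det ∇U + a (2 ∫ φ_R ‖∇U‖²_F − Z_R)`;
* `productionLever_static_bound` — the lever without the time derivative, forcing
  `K s := (6Cc₁ + 2c₂) E(2R,s)/R + 4aκ'⁺ √(E(2R,s)/R)`;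
* `stub_signedBudgetProduction` — the registered sub-goal: `stub_signedBudget` with `hΛ` replaced by `hprod`.

Everything else (flux bounds, cutoff lemmas, `Z_R'` and the enstrophy identity) is cited from the
sibling files `SqueezeCycleMustSqueezeSignedBudget{Flux,Static,}` (proofs by DrefuteG2 / the 11610 lead).
-/

noncomputable section

open MeasureTheory Set Filter Real Metric
open scoped ContDiff RealInnerProductSpace Laplacian
open Literature.Analysis.FluidPDE

set_option linter.dupNamespace false

namespace Summit.NavierStokesRegularity.NavierStokesRegularity.Theorems

variable {C a : ℝ} {u : ℝ → EuclideanSpace ℝ (Fin 3) → EuclideanSpace ℝ (Fin 3)}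

/-! ## The integrated production bound, production currency -/

-- adapted from Theorems/SqueezeCycleMustSqueezeSignedBudgetStatic.lean (DrefuteG2 / 11610 lead)
/-- **`∫ φ ⟪∇U Ω, Ω⟫ ≤ 4 ∫ φ det ∇U + a (2 ∫ φ ‖∇U‖²_F − Z)`** from the POINTWISE production bound
`hprod : ⟪∇U Ω, Ω⟫ ≤ 4 det ∇U + a (2‖∇U‖²_F − ‖Ω‖²)` (integrate against the nonnegative cutoff
`φ_R(y) = smoothTransition (2 − ‖y‖²/R²)`; all integrands are continuous with compact support). -/
theorem productionLever_production_integral_le (hu : IsTypeIAncientMild C u)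
    (hprod : ∀ (s : ℝ) (y : EuclideanSpace ℝ (Fin 3)),
      ⟪fderiv ℝ (lerayOrbit u s) y (lerayVorticity u s y), lerayVorticity u s y⟫ ≤
        4 * LinearMap.det (fderiv ℝ (lerayOrbit u s) y : EuclideanSpace ℝ (Fin 3) →ₗ[ℝ] EuclideanSpace ℝ (Fin 3)) +
          a * (2 * frobeniusNormSq (fderiv ℝ (lerayOrbit u s) y) - ‖lerayVorticity u s y‖ ^ 2))
    {R : ℝ} (hR : 0 < R) (s : ℝ) :
    (∫ y, smoothTransition (2 - ‖y‖ ^ 2 / R ^ 2) *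
        ⟪fderiv ℝ (lerayOrbit u s) y (lerayVorticity u s y), lerayVorticity u s y⟫) ≤
      4 * (∫ y, smoothTransition (2 - ‖y‖ ^ 2 / R ^ 2) *
          LinearMap.det (fderiv ℝ (lerayOrbit u s) y : EuclideanSpace ℝ (Fin 3) →ₗ[ℝ] EuclideanSpace ℝ (Fin 3))) +
        a * (2 * (∫ y, smoothTransition (2 - ‖y‖ ^ 2 / R ^ 2) * frobeniusNormSq (fderiv ℝ (lerayOrbit u s) y)) -
          ∫ y, smoothTransition (2 - ‖y‖ ^ 2 / R ^ 2) * ‖lerayVorticity u s y‖ ^ 2) := by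
  set φ : EuclideanSpace ℝ (Fin 3) → ℝ := fun z => smoothTransition (2 - ‖z‖ ^ 2 / R ^ 2) with hφdef
  have hφc : HasCompactSupport φ := hasCompactSupport_smoothTransition_cutoff hR
  have hφcont : Continuous φ := (contDiff_smoothTransition_cutoff (n := 0) R).continuous
  have hφ0 : ∀ y, 0 ≤ φ y := fun y => smoothTransition_cutoff_nonneg R y
  have hcDU : Continuous (fderiv ℝ (lerayOrbit u s)) :=
    (mustSqueeze_contDiff_lerayOrbit_slice hu s (n := 1)).continuous_fderiv one_ne_zero
  have hcΩ : Continuous (lerayVorticity u s) := signedBudget_continuous_lerayVorticity hu s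
  have hcF : Continuous fun y => frobeniusNormSq (fderiv ℝ (lerayOrbit u s) y) :=
    mustSqueeze_continuous_frobeniusNormSq_fderiv_lerayOrbit hu s
  have hcdet : Continuous fun y => LinearMap.det (fderiv ℝ (lerayOrbit u s) y : EuclideanSpace ℝ (Fin 3) →ₗ[ℝ] EuclideanSpace ℝ (Fin 3)) :=
    ContinuousLinearMap.continuous_det.comp hcDU
  have hcP : Continuous fun y => ⟪fderiv ℝ (lerayOrbit u s) y (lerayVorticity u s y), lerayVorticity u s y⟫ :=
    (hcDU.clm_apply hcΩ).inner hcΩ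
  -- integrability (continuous × compactly supported cutoff)
  have iP : Integrable fun y => φ y * ⟪fderiv ℝ (lerayOrbit u s) y (lerayVorticity u s y), lerayVorticity u s y⟫ :=
    (hφcont.mul hcP).integrable_of_hasCompactSupport hφc.mul_right
  have idet : Integrable fun y => φ y * LinearMap.det (fderiv ℝ (lerayOrbit u s) y : EuclideanSpace ℝ (Fin 3) →ₗ[ℝ] EuclideanSpace ℝ (Fin 3)) :=
    (hφcont.mul hcdet).integrable_of_hasCompactSupport hφc.mul_right
  have iF : Integrable fun y => φ y * frobeniusNormSq (fderiv ℝ (lerayOrbit u s) y) :=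
    (hφcont.mul hcF).integrable_of_hasCompactSupport hφc.mul_right
  have iZ : Integrable fun y => φ y * ‖lerayVorticity u s y‖ ^ 2 :=
    (hφcont.mul (hcΩ.norm.pow 2)).integrable_of_hasCompactSupport hφc.mul_right
  have iG : Integrable fun y => 4 * (φ y * LinearMap.det (fderiv ℝ (lerayOrbit u s) y : EuclideanSpace ℝ (Fin 3) →ₗ[ℝ] EuclideanSpace ℝ (Fin 3))) +
      a * (2 * (φ y * frobeniusNormSq (fderiv ℝ (lerayOrbit u s) y)) - φ y * ‖lerayVorticity u s y‖ ^ 2) :=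
    (idet.const_mul 4).add (((iF.const_mul 2).sub iZ).const_mul a)
  -- pointwise: multiply `hprod` by the nonnegative cutoff
  have hpt : ∀ y, φ y * ⟪fderiv ℝ (lerayOrbit u s) y (lerayVorticity u s y), lerayVorticity u s y⟫ ≤
      4 * (φ y * LinearMap.det (fderiv ℝ (lerayOrbit u s) y : EuclideanSpace ℝ (Fin 3) →ₗ[ℝ] EuclideanSpace ℝ (Fin 3))) +
        a * (2 * (φ y * frobeniusNormSq (fderiv ℝ (lerayOrbit u s) y)) - φ y * ‖lerayVorticity u s y‖ ^ 2) := by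
    intro y
    have h := mul_le_mul_of_nonneg_left (hprod s y) (hφ0 y)
    have e : φ y * (4 * LinearMap.det (fderiv ℝ (lerayOrbit u s) y : EuclideanSpace ℝ (Fin 3) →ₗ[ℝ] EuclideanSpace ℝ (Fin 3)) +
        a * (2 * frobeniusNormSq (fderiv ℝ (lerayOrbit u s) y) - ‖lerayVorticity u s y‖ ^ 2)) =
        4 * (φ y * LinearMap.det (fderiv ℝ (lerayOrbit u s) y : EuclideanSpace ℝ (Fin 3) →ₗ[ℝ] EuclideanSpace ℝ (Fin 3))) +
          a * (2 * (φ y * frobeniusNormSq (fderiv ℝ (lerayOrbit u s) y)) - φ y * ‖lerayVorticity u s y‖ ^ 2) := by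
      ring
    rw [e] at h
    exact h
  have hmono := integral_mono iP iG hpt
  have i1 : Integrable fun y => 4 * (φ y * LinearMap.det (fderiv ℝ (lerayOrbit u s) y : EuclideanSpace ℝ (Fin 3) →ₗ[ℝ] EuclideanSpace ℝ (Fin 3))) :=
    idet.const_mul 4
  have i23 : Integrable fun y => 2 * (φ y * frobeniusNormSq (fderiv ℝ (lerayOrbit u s) y)) -
      φ y * ‖lerayVorticity u s y‖ ^ 2 := (iF.const_mul 2).sub iZ
  have i2 : Integrable fun y => a * (2 * (φ y * frobeniusNormSq (fderiv ℝ (lerayOrbit u s) y)) -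
      φ y * ‖lerayVorticity u s y‖ ^ 2) := i23.const_mul a
  have eA : (∫ y, 4 * (φ y * LinearMap.det (fderiv ℝ (lerayOrbit u s) y : EuclideanSpace ℝ (Fin 3) →ₗ[ℝ] EuclideanSpace ℝ (Fin 3))) +
      a * (2 * (φ y * frobeniusNormSq (fderiv ℝ (lerayOrbit u s) y)) - φ y * ‖lerayVorticity u s y‖ ^ 2)) =
      (∫ y, 4 * (φ y * LinearMap.det (fderiv ℝ (lerayOrbit u s) y : EuclideanSpace ℝ (Fin 3) →ₗ[ℝ] EuclideanSpace ℝ (Fin 3)))) +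
        ∫ y, a * (2 * (φ y * frobeniusNormSq (fderiv ℝ (lerayOrbit u s) y)) - φ y * ‖lerayVorticity u s y‖ ^ 2) :=
    integral_add i1 i2
  have eB : (∫ y, 4 * (φ y * LinearMap.det (fderiv ℝ (lerayOrbit u s) y : EuclideanSpace ℝ (Fin 3) →ₗ[ℝ] EuclideanSpace ℝ (Fin 3)))) =
      4 * ∫ y, φ y * LinearMap.det (fderiv ℝ (lerayOrbit u s) y : EuclideanSpace ℝ (Fin 3) →ₗ[ℝ] EuclideanSpace ℝ (Fin 3)) :=
    integral_const_mul _ _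
  have eC : (∫ y, a * (2 * (φ y * frobeniusNormSq (fderiv ℝ (lerayOrbit u s) y)) - φ y * ‖lerayVorticity u s y‖ ^ 2)) =
      a * ∫ y, (2 * (φ y * frobeniusNormSq (fderiv ℝ (lerayOrbit u s) y)) - φ y * ‖lerayVorticity u s y‖ ^ 2) :=
    integral_const_mul _ _
  have eD : (∫ y, (2 * (φ y * frobeniusNormSq (fderiv ℝ (lerayOrbit u s) y)) - φ y * ‖lerayVorticity u s y‖ ^ 2)) =
      (∫ y, 2 * (φ y * frobeniusNormSq (fderiv ℝ (lerayOrbit u s) y))) - ∫ y, φ y * ‖lerayVorticity u s y‖ ^ 2 :=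
    integral_sub (iF.const_mul 2) iZ
  have eE : (∫ y, 2 * (φ y * frobeniusNormSq (fderiv ℝ (lerayOrbit u s) y))) =
      2 * ∫ y, φ y * frobeniusNormSq (fderiv ℝ (lerayOrbit u s) y) :=
    integral_const_mul _ _
  have hsum : (∫ y, 4 * (φ y * LinearMap.det (fderiv ℝ (lerayOrbit u s) y : EuclideanSpace ℝ (Fin 3) →ₗ[ℝ] EuclideanSpace ℝ (Fin 3))) +
      a * (2 * (φ y * frobeniusNormSq (fderiv ℝ (lerayOrbit u s) y)) - φ y * ‖lerayVorticity u s y‖ ^ 2)) =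
      4 * (∫ y, φ y * LinearMap.det (fderiv ℝ (lerayOrbit u s) y : EuclideanSpace ℝ (Fin 3) →ₗ[ℝ] EuclideanSpace ℝ (Fin 3))) +
        a * (2 * (∫ y, φ y * frobeniusNormSq (fderiv ℝ (lerayOrbit u s) y)) -
          ∫ y, φ y * ‖lerayVorticity u s y‖ ^ 2) := by
    rw [eA, eB, eC, eD, eE]
  rw [hsum] at hmono
  exact hmono

/-! ## The static half, production currency -/

-- adapted from Theorems/SqueezeCycleMustSqueezeSignedBudgetStatic.lean (DrefuteG2 / 11610 lead)
/-- **The lever without the time derivative, production currency.**  For `R ≥ 1` put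
`K s := κ₀ E(2R,s)/R + 4aκ'⁺ √(E(2R,s)/R)`, `κ₀ = 6 C c₁ + 2 c₂`.  Then `K` is continuous,
nonnegative, `K ≤ κ (E/R + √(E/R))` with `κ = max κ₀ (4aκ'⁺)`, and
`−½Z + ½∫(y·∇φ)‖Ω‖² + ∫(U·∇φ)‖Ω‖² + 2∫φ⟪∇UΩ,Ω⟫ + ∫‖Ω‖²Δφ ≤ −2(¼ − a) Z + K`, the production term
being controlled by `productionLever_production_integral_le` (hypothesis `hprod`) and the four fluxes by the
sibling's `signedBudget_cubic_flux_le`, `signedBudget_transport_flux_le`, `signedBudget_viscous_flux_le`,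
`signedBudget_drift_flux_nonpos`. -/
theorem productionLever_static_bound (C a κ' : ℝ) (u : ℝ → EuclideanSpace ℝ (Fin 3) → EuclideanSpace ℝ (Fin 3)) (hu : IsTypeIAncientMild C u)
    (hprod : ∀ (s : ℝ) (y : EuclideanSpace ℝ (Fin 3)),
      ⟪fderiv ℝ (lerayOrbit u s) y (lerayVorticity u s y), lerayVorticity u s y⟫ ≤
        4 * LinearMap.det (fderiv ℝ (lerayOrbit u s) y : EuclideanSpace ℝ (Fin 3) →ₗ[ℝ] EuclideanSpace ℝ (Fin 3)) +
          a * (2 * frobeniusNormSq (fderiv ℝ (lerayOrbit u s) y) - ‖lerayVorticity u s y‖ ^ 2))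
    (ha : 0 ≤ a)
    (hUC : ∀ (s : ℝ) (y : EuclideanSpace ℝ (Fin 3)), ‖lerayOrbit u s y‖ ≤ C)
    (hEcont : ∀ ρ : ℝ, 0 < ρ →
      Continuous fun s => ∫ y in Metric.ball (0 : EuclideanSpace ℝ (Fin 3)) ρ, frobeniusNormSq (fderiv ℝ (lerayOrbit u s) y))
    (hcmp : ∀ (R s : ℝ), 1 ≤ R →
      (∫ y, smoothTransition (2 - ‖y‖ ^ 2 / R ^ 2) * frobeniusNormSq (fderiv ℝ (lerayOrbit u s) y)) ≤
        (∫ y, smoothTransition (2 - ‖y‖ ^ 2 / R ^ 2) * ‖lerayVorticity u s y‖ ^ 2) +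
          κ' * Real.sqrt ((∫ y in Metric.ball (0 : EuclideanSpace ℝ (Fin 3)) (2 * R),
            frobeniusNormSq (fderiv ℝ (lerayOrbit u s) y)) / R)) :
    ∃ κ : ℝ, ∀ R : ℝ, 1 ≤ R →
      ∃ K : ℝ → ℝ, Continuous K ∧ (∀ s, 0 ≤ K s) ∧
        (∀ s, K s ≤ κ * ((∫ y in Metric.ball (0 : EuclideanSpace ℝ (Fin 3)) (2 * R), frobeniusNormSq (fderiv ℝ (lerayOrbit u s) y)) / R +
          Real.sqrt ((∫ y in Metric.ball (0 : EuclideanSpace ℝ (Fin 3)) (2 * R), frobeniusNormSq (fderiv ℝ (lerayOrbit u s) y)) / R))) ∧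
        ∀ s, -(1 / 2) * (∫ y, smoothTransition (2 - ‖y‖ ^ 2 / R ^ 2) * ‖lerayVorticity u s y‖ ^ 2)
            + (1 / 2) * (∫ y, fderiv ℝ (fun z : EuclideanSpace ℝ (Fin 3) => smoothTransition (2 - ‖z‖ ^ 2 / R ^ 2)) y y *
                ‖lerayVorticity u s y‖ ^ 2)
            + (∫ y, fderiv ℝ (fun z : EuclideanSpace ℝ (Fin 3) => smoothTransition (2 - ‖z‖ ^ 2 / R ^ 2)) y (lerayOrbit u s y) *
                ‖lerayVorticity u s y‖ ^ 2)
            + 2 * (∫ y, smoothTransition (2 - ‖y‖ ^ 2 / R ^ 2) *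
                ⟪fderiv ℝ (lerayOrbit u s) y (lerayVorticity u s y), lerayVorticity u s y⟫)
            + (∫ y, ‖lerayVorticity u s y‖ ^ 2 *
                (Δ (fun z : EuclideanSpace ℝ (Fin 3) => smoothTransition (2 - ‖z‖ ^ 2 / R ^ 2))) y)
          ≤ -(2 * (1 / 4 - a)) * (∫ y, smoothTransition (2 - ‖y‖ ^ 2 / R ^ 2) * ‖lerayVorticity u s y‖ ^ 2)
              + K s := by
  obtain ⟨c₁, hc₁0, hc₁⟩ := exists_norm_fderiv_smoothTransition_cutoff_le (E := EuclideanSpace ℝ (Fin 3))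
  obtain ⟨c₂, hc₂0, hc₂⟩ := exists_abs_laplacian_smoothTransition_cutoff_le (E := EuclideanSpace ℝ (Fin 3))
  have hC : 0 ≤ C := hu.nonneg
  have hk0 : 0 ≤ max κ' 0 := le_max_right _ _
  refine ⟨max (6 * C * c₁ + 2 * c₂) (4 * a * max κ' 0), fun R hR1 => ?_⟩
  have hR : 0 < R := lt_of_lt_of_le one_pos hR1
  -- the forcing
  refine ⟨fun s => (6 * C * c₁ + 2 * c₂) *
      ((∫ y in Metric.ball (0 : EuclideanSpace ℝ (Fin 3)) (2 * R), frobeniusNormSq (fderiv ℝ (lerayOrbit u s) y)) / R) +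
      4 * a * max κ' 0 *
        Real.sqrt ((∫ y in Metric.ball (0 : EuclideanSpace ℝ (Fin 3)) (2 * R), frobeniusNormSq (fderiv ℝ (lerayOrbit u s) y)) / R),
    ?_, ?_, ?_, ?_⟩
  · -- continuity
    have hE := hEcont (2 * R) (by positivity)
    exact ((hE.div_const R).const_mul _).add ((hE.div_const R).sqrt.const_mul _)
  · -- nonnegativity
    intro s
    have hE0 := mustSqueeze_ballGradEnergy_nonneg u (2 * R) s
    positivity
  · -- comparison with `κ (E/R + √(E/R))`
    intro s
    set X : ℝ := (∫ y in Metric.ball (0 : EuclideanSpace ℝ (Fin 3)) (2 * R), frobeniusNormSq (fderiv ℝ (lerayOrbit u s) y)) / R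
    have hX : 0 ≤ X := div_nonneg (mustSqueeze_ballGradEnergy_nonneg u (2 * R) s) hR.le
    have hS : 0 ≤ Real.sqrt X := Real.sqrt_nonneg _
    rw [mul_add]
    exact add_le_add (mul_le_mul_of_nonneg_right (le_max_left _ _) hX)
      (mul_le_mul_of_nonneg_right (le_max_right _ _) hS)
  · -- the inequality
    intro s
    beta_reduce
    set Z : ℝ := ∫ y, smoothTransition (2 - ‖y‖ ^ 2 / R ^ 2) * ‖lerayVorticity u s y‖ ^ 2 with hZ
    set E2 : ℝ := ∫ y in Metric.ball (0 : EuclideanSpace ℝ (Fin 3)) (2 * R), frobeniusNormSq (fderiv ℝ (lerayOrbit u s) y) with hE2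
    set Idet : ℝ := ∫ y, smoothTransition (2 - ‖y‖ ^ 2 / R ^ 2) *
        LinearMap.det (fderiv ℝ (lerayOrbit u s) y : EuclideanSpace ℝ (Fin 3) →ₗ[ℝ] EuclideanSpace ℝ (Fin 3)) with hIdet
    set Ifrob : ℝ := ∫ y, smoothTransition (2 - ‖y‖ ^ 2 / R ^ 2) *
        frobeniusNormSq (fderiv ℝ (lerayOrbit u s) y) with hIfrob
    set P : ℝ := ∫ y, smoothTransition (2 - ‖y‖ ^ 2 / R ^ 2) *
        ⟪fderiv ℝ (lerayOrbit u s) y (lerayVorticity u s y), lerayVorticity u s y⟫ with hP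
    set D : ℝ := ∫ y, fderiv ℝ (fun z : EuclideanSpace ℝ (Fin 3) => smoothTransition (2 - ‖z‖ ^ 2 / R ^ 2)) y y *
        ‖lerayVorticity u s y‖ ^ 2 with hD
    set T : ℝ := ∫ y, fderiv ℝ (fun z : EuclideanSpace ℝ (Fin 3) => smoothTransition (2 - ‖z‖ ^ 2 / R ^ 2)) y (lerayOrbit u s y) *
        ‖lerayVorticity u s y‖ ^ 2 with hT
    set V : ℝ := ∫ y, ‖lerayVorticity u s y‖ ^ 2 *
        (Δ (fun z : EuclideanSpace ℝ (Fin 3) => smoothTransition (2 - ‖z‖ ^ 2 / R ^ 2))) y with hV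
    set S : ℝ := Real.sqrt (E2 / R) with hS
    have hE0 : 0 ≤ E2 := mustSqueeze_ballGradEnergy_nonneg u (2 * R) s
    have hX0 : 0 ≤ E2 / R := div_nonneg hE0 hR.le
    have hS0 : 0 ≤ S := Real.sqrt_nonneg _
    -- the five estimates
    have h1 : Idet ≤ (1 / 2) * (C * c₁ * (E2 / R)) := by
      have h := (abs_le.1 (signedBudget_cubic_flux_le hu hUC hc₁ hR s)).2
      have e : (1 / 2) * C * (c₁ / R) * E2 = (1 / 2) * (C * c₁ * (E2 / R)) := by ring
      linarith
    have h2 : T ≤ 2 * (C * c₁ * (E2 / R)) := by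
      have h := (abs_le.1 (signedBudget_transport_flux_le hu hUC hc₁ hR s)).2
      have e : 2 * C * (c₁ / R) * E2 = 2 * (C * c₁ * (E2 / R)) := by ring
      linarith
    have h3 : V ≤ 2 * (c₂ * (E2 / R)) := by
      have h := (abs_le.1 (signedBudget_viscous_flux_le hu hc₂ hR s)).2
      have hRR : c₂ / R ^ 2 ≤ c₂ / R :=
        div_le_div_of_nonneg_left hc₂0 hR (by nlinarith)
      have e : 2 * (c₂ / R) * E2 = 2 * (c₂ * (E2 / R)) := by ring
      nlinarith
    have h4 : D ≤ 0 := signedBudget_drift_flux_nonpos u R s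
    have h5 : P ≤ 4 * Idet + 2 * (a * Ifrob) - a * Z := by
      have h := productionLever_production_integral_le hu hprod hR s
      have e : a * (2 * Ifrob - Z) = 2 * (a * Ifrob) - a * Z := by ring
      linarith
    have h6 : a * Ifrob ≤ a * Z + a * (max κ' 0 * S) := by
      have hc := hcmp R s hR1
      have hκ : κ' * S ≤ max κ' 0 * S := mul_le_mul_of_nonneg_right (le_max_left _ _) hS0
      have hI : Ifrob ≤ Z + max κ' 0 * S := by linarith
      have h := mul_le_mul_of_nonneg_left hI ha
      have e : a * (Z + max κ' 0 * S) = a * Z + a * (max κ' 0 * S) := by ring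
      linarith
    -- normalise the target and close linearly
    have eZ : -(2 * (1 / 4 - a)) * Z = -(1 / 2) * Z + 2 * (a * Z) := by ring
    have eK : (6 * C * c₁ + 2 * c₂) * (E2 / R) + 4 * a * max κ' 0 * S =
        6 * (C * c₁ * (E2 / R)) + 2 * (c₂ * (E2 / R)) + 4 * (a * (max κ' 0 * S)) := by ring
    rw [eZ, eK]
    linarith

/-! ## The lever in production currency (registered sub-goal) -/

-- adapted from Theorems/SqueezeCycleMustSqueezeSignedBudget.lean (DrefuteG2 / 11610 lead)
/-- **Registered sub-goal `stub_signedBudgetProduction`** (line `quarter-bootstrap-pinning`): the sibling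
lever `Theorems.stub_signedBudget` — the localised similarity enstrophy inequality
`Z_R' ≤ −2(¼ − a) Z_R + K_R` with `Z_R(s) = ∫ φ_R ‖Ω(s)‖²`, `K_R` continuous, `0 ≤ K_R ≤ κ (E(2R)/R + √(E(2R)/R))`
uniformly in `R ≥ 1` — with its middle-eigenvalue hypothesis `Λ_u ≤ a` REPLACED by the pointwise
production bound on the similarity orbit `⟪∇U Ω, Ω⟫ ≤ 4 det ∇U + a (2‖∇U‖²_F − ‖Ω‖²)` (all `s`, `y`),
`0 ≤ a`.  Proof: `productionLever_static_bound` for the static half; `Z_R` is differentiable with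
`Z_R' = −½Z + ½∫(y·∇φ_R)‖Ω‖² + ∫(U·∇φ_R)‖Ω‖² + 2∫φ_R⟪∇UΩ,Ω⟫ + ∫‖Ω‖²Δφ_R − 2∫φ_R‖∇Ω‖²_F`
(`signedBudget_hasDerivAt_cutoffEnstrophy`, `signedBudget_deriv_cutoffEnstrophy_eq`), and the
dissipation is dropped. -/
theorem stub_signedBudgetProduction : ∀ (C a κ' : ℝ) (u : ℝ → EuclideanSpace ℝ (Fin 3) → EuclideanSpace ℝ (Fin 3)), Literature.Analysis.FluidPDE.IsTypeIAncientMild C u → (∀ (s : ℝ) (y : EuclideanSpace ℝ (Fin 3)), inner ℝ (fderiv ℝ (Literature.Analysis.FluidPDE.lerayOrbit u s) y (Literature.Analysis.FluidPDE.lerayVorticity u s y)) (Literature.Analysis.FluidPDE.lerayVorticity u s y) ≤ 4 * LinearMap.det (fderiv ℝ (Literature.Analysis.FluidPDE.lerayOrbit u s) y : EuclideanSpace ℝ (Fin 3) →ₗ[ℝ] EuclideanSpace ℝ (Fin 3)) + a * (2 * Literature.Analysis.FluidPDE.frobeniusNormSq (fderiv ℝ (Literature.Analysis.FluidPDE.lerayOrbit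 u s) y) - ‖Literature.Analysis.FluidPDE.lerayVorticity u s y‖ ^ 2)) → 0 ≤ a → (∀ (s : ℝ) (y : EuclideanSpace ℝ (Fin 3)), ‖Literature.Analysis.FluidPDE.lerayOrbit u s y‖ ≤ C) → (∀ ρ : ℝ, 0 < ρ → Continuous fun s => ∫ y in Metric.ball (0 : EuclideanSpace ℝ (Fin 3)) ρ, Literature.Analysis.FluidPDE.frobeniusNormSq (fderiv ℝ (Literature.Analysis.FluidPDE.lerayOrbit u s) y)) → (∀ (R s : ℝ), 1 ≤ R → (∫ y, Real.smoothTransition (2 - ‖y‖ ^ 2 / R ^ 2) * Literature.Analysis.FluidPDE.frobeniusNormSq (fderiv ℝ (Literature.Analysis.FluidPDE.lerayOrbit u s) y)) ≤ (∫ y, Real.smoothTransition (2 - ‖y‖ ^ 2 / R ^ 2) * ‖Literature.Analysis.FluidPDE.lerayVorticity u s y‖ ^ 2) + κ' * Real.sqrt ((∫ y in Metric.ball (0 : EuclideanSpace ℝ (Fin 3)) (2 * R), Literature.Analysis.FluidPDE.frobeniusNormSq (fderiv ℝ (Literature.Analysis.FluidPDE.lerayOrbit u s) y)) / R)) → ∃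 κ : ℝ, ∀ R : ℝ, 1 ≤ R → Differentiable ℝ (fun s => ∫ y, Real.smoothTransition (2 - ‖y‖ ^ 2 / R ^ 2) * ‖Literature.Analysis.FluidPDE.lerayVorticity u s y‖ ^ 2) ∧ ∃ K : ℝ → ℝ, Continuous K ∧ (∀ s, 0 ≤ K s) ∧ (∀ s, K s ≤ κ * ((∫ y in Metric.ball (0 : EuclideanSpace ℝ (Fin 3)) (2 * R), Literature.Analysis.FluidPDE.frobeniusNormSq (fderiv ℝ (Literature.Analysis.FluidPDE.lerayOrbit u s) y)) / R + Real.sqrt ((∫ y in Metric.ball (0 : EuclideanSpace ℝ (Fin 3)) (2 * R), Literature.Analysis.FluidPDE.frobeniusNormSq (fderiv ℝ (Literature.Analysis.FluidPDE.lerayOrbit u s) y)) / R))) ∧ ∀ s, deriv (fun s => ∫ y, Real.smoothTransition (2 - ‖y‖ ^ 2 / R ^ 2) * ‖Literature.Analysis.FluidPDE.lerayVorticity u s y‖ ^ 2) s ≤ -(2 * (1 / 4 - a)) * (∫ y, Real.smoothTransition (2 - ‖y‖ ^ 2 / R ^ 2) * ‖Literature.Analysis.FluidPDE.lerayVorticity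 u s y‖ ^ 2) + K s := by
  intro C a κ' u hu hprod ha hUC hEcont hcmp
  obtain ⟨κ, hκ⟩ := productionLever_static_bound C a κ' u hu hprod ha hUC hEcont hcmp
  refine ⟨κ, fun R hR1 => ?_⟩
  have hR : 0 < R := lt_of_lt_of_le one_pos hR1
  obtain ⟨K, hKc, hK0, hKle, hmain⟩ := hκ R hR1
  refine ⟨fun s => (signedBudget_hasDerivAt_cutoffEnstrophy hu hR s).differentiableAt, K, hKc, hK0, hKle, fun s => ?_⟩
  rw [signedBudget_deriv_cutoffEnstrophy_eq hu hR s]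
  have hdiss : 0 ≤ ∫ y, smoothTransition (2 - ‖y‖ ^ 2 / R ^ 2) *
      frobeniusNormSq (fderiv ℝ (lerayVorticity u s) y) :=
    integral_nonneg fun y => mul_nonneg (smoothTransition_cutoff_nonneg R y) (frobeniusNormSq_nonneg _)
  linarith [hmain s]

end Summit.NavierStokesRegularity.NavierStokesRegularity.Theorems

end
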